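/-
COR-CM (cells pub-hodgecm / pub-hodgecm2, stage 2 of the Hodge ladder) — TRANSPOSITION SURGE, item (vi) sub-binder S2 / (vi-2)
`supply`: the PINNED as-printed junction (hodge-director/ITEM6-SPLIT.md §(c′) (vi-2) MATCH-SPLIT and §5; x2 `PIN-SKETCH.md`
20f97246f9eb; binder-1 `CorCM/CMSideReachTransfer.lean` USE note and `CorCM/CMSideReachOfInverseType.lean`).  Seat
prover-pub-hodgecm-own-htheta-g3-0 (own-htheta gen 3, owner of the item-(vi) lineage; rule-(1) path claim pub-hodgecm2/INBOX
2026-08-21T15:13:30Z, lead ACK 15:19:39Z).  Theorems only: no definition, no instance, no named fact, nothing asserted, no proof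
holes.  `Transposition/Assembly.lean` (p271429), `Item6SupplyAssembly.lean` (p272758), `Item6SupplyReach.lean` (p278665),
`Item6HoldsRec.lean` (p279831), item6-p1's `Item6SupplyAsPrinted.lean` and tr-prover-6's `HCCMOfAsPrinted.lean` are untouched; decl
names carry the `_pinned` suffix.  FRAMING: HC_CM is NOT proved.

CONSISTENCY (lead ACK condition (i); coordinator ruling 2026-08-21T15:33:56Z (3) «T5»): every binder below is GUARDED to the
consumed range `IsGalois ℚ F → 6 ≤ [F:ℚ] → ι₁ ∈ Φ` (pub-hodgecm2 lead RULING «AS-PRINTED JUNCTION T1»).  T5-style check OF THESE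
BYTES' binder family (eight binders) by htheta-x2 g3, 2026-08-21T16:00:05Z, memo `pub-hodgecm-own-htheta/x2/PINNED-JUNCTION-T1-v4.md`
5e87ef24cf9a (= `hodge-director/audit-eod/PINNED-JUNCTION-T1-v4-x2g3.md`): the refutation attempt
(`x2/probes/probe_x2_s2junction_t1.refutation_attempt.lean` 14a38dad1b3e) ends rc 1 with the single stuck goal
`⊢ 6 ≤ Module.finrank ℚ F₀.K` (i.e. `6 ≤ 2`; the witness `F₀ = ℚ(ζ₄)` of the unguarded family is excluded by the guard) — NO
contradiction derived; and independently `(∃ D Aμ, eight binders) ↔ SocketReach ↔ U.FaceSupply` (probe v7 6ccb0effb6b4, 31/31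
axioms trio).  STRENGTH (condition (ii)), in the kernel, companion file
`Item6SupplyPinnedCertificate.lean`: for every datum satisfying `hLiu`/`hObj`/`hChi`/`hirr`/`hsm`/`hμ`, «some pin `Aμ` satisfies
(hCM, hReach)» ↔ B01-S `U.FaceSupply`, and «some (D, Aμ) satisfies all eight binders» ↔ `U.FaceSupply` — AGAIN ↔ B01-S (hence
↔ x2's `SocketReach`): the pin adds no kernel content toward S2; it re-classifies the residual.
-/
import Literature.NumberTheory.Automorphic.Liu2021.Thm418Invariants
import Summits.HodgeConjecture.CorCM.B01.Transposition.Item6HoldsRec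
import Summits.HodgeConjecture.CorCM.B01.Transposition.Item6SupplyReach
import Summits.HodgeConjecture.CorCM.CMSideReachOfInverseType
import HarnessLib

/-!
# Item (vi) S2 from [Liu 2021, Thm. 4.18] AS PRINTED at a PINNED datum — the object match split into printed sentences

The junction of record for the as-printed rewire (tr-prover-6 `HCCMOfAsPrinted.lean`, item6-p1 `Item6SupplyAsPrinted.lean`)
derives B01-S `U.FaceSupply` from the cite binder `hLiu : Thm418AsPrinted (D …)` ([Liu2021] Thm. 4.18 exactly as printed,
`Literature.NumberTheory.Automorphic.Liu2021.Thm418AsPrinted`, lit-liu-asprinted) plus the carriers `hObj` / `hChi` / `hω` (here: `hω`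
in Def. 4.11's own words, `hirr` + `hsm`) and ONE
further binder `hMatch` — «a non-zero element of `Hom_E(A_K, A_μ)_ℚ` gives a non-zero `Alb(P_Γ(V)) → A_{(F,Φ)}`» — classified in
ITEM6-SPLIT §5 as NOT printed and NOT a tree theorem (U1–U3), and certified (`thm418AsPrinted_match_iff_faceSupply`) to be, given
the other four, EQUIVALENT to B01-S.  The reason it cannot be split there: `Thm418Data` carries `Hom_E(A_K, A_μ)_ℚ` as a bare
additive group `HomK K D_μ`, with NO abelian variety `A_μ` to speak about.

This file PINS the one missing real object — per object `D_μ ∈ 𝒜(μ)` a complex abelian variety `Aμ … D_μ : AbelianVariety ℂ`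
(intended: `A_μ ⊗_{E,ι₁} ℂ`, [Liu2021] Def. 4.5 (2)) — and splits `hMatch` along it into sentences of the paper (x2 PIN-SKETCH
§2; binder-1 USE note), every one for the datum's OWN character `μ` (the REAL field `Thm418Data.μ`, CM type `Thm418Data.cmType`):

* **(hμ) — the consumer's CHOICE of `μ`**: the CM type `Φ_μ` of the datum's `μ` is the INVERSE TYPE of `Φ` through `ι₁`,
  `ι₁ ∘ g ∈ Φ_μ ↔ ι₁ ∘ g⁻¹ ∈ Φ` for `g ∈ Gal(F/ℚ)` (`Φ_μ = Φ^{*ι₁} = Transposition.invType ι₁ Φ`, item (ii)).  Not a hypothesis of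
  anything printed — a choice, always available: a weight-one conjugate symplectic character of ANY prescribed CM type exists
  (`IdeleClassGroup.exists_isConjugateSymplectic_hasCMType`, tree theorem); the certificate file exhibits such data.
* **(hCM) = C6b\*, the CM side, VERBATIM [Liu2021] Def. 4.5 (2) at the dictionary** — «`A_μ ⊗_{E,ι₁} ℂ` carries a CM structure
  by a CM field `M` (intended `M_μ`) realising, on `H¹`, the CM type INDUCED along some `e : K* → M` from THE REFLEX PAIR
  `(K*, Φ_μ*) = (reflexField ℚ F (Φ_μ)_F, reflexCMType ι₁ Φ_μ id)` of `(F, Φ_μ)` read through `ι₁`».  PRINTED as: [Liu2021] Def. 4.5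
  (`de:cm_data`, `FJcycle.tex` l. 1936–1964): (1) l. 1939–1942 «`η_μ := η'_μ ∘ Nm_{M_μ/M'_μ}`», `η'_μ` the reciprocity map of
  `M'_μ`; (2) l. 1944–1951 «`A_μ` is an abelian variety over `E`», «`i_μ : M_μ → End_E(A_μ)_ℚ` is a CM structure such that — for
  every `x ∈ M_μ`, the determinant of the action of `i_μ(x)` on the `E`-vector space `Lie_E(A_μ)` equals `η_μ(x)`»; and Def. 4.3
  (2) (`de:conjugate2`, l. 1919) «we denote by `M'_μ ⊆ ℂ` the reflex field of `(E, Φ_μ)`, with the induced CM type `Ψ_μ`»: the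
  type of `A_μ ⊗_{E,ι₁} ℂ` over `M_μ` is induced from `(M'_μ, Ψ_μ)` (tree reading of exactly this bullet:
  `Literature.AlgebraicGeometry.Liu2021.LiuCMData.cmType_eq_induced_of_det45`), and `(M'_μ, Ψ_μ) ≅ (K*, Φ_μ*)` (Shimura 1998 §8.3
  Prop. 28; `E = F` Galois, so `M'_μ ⊆ ι₁(F)` and `K* = ι₁⁻¹(M'_μ) ⊆ F`).  Consumed AS A CONSEQUENCE of those two printed
  definitions; the identification `M'_μ ≅ K*` is construction data of the datum.  Uniform in `[F:ℚ]` and in the face.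
* **(hReach) = C0 / C6a, the SHIMURA–ALBANESE side** — «for `K` SUFFICIENTLY SMALL (below some open compact `Ksm`; §4.2 l. 2060
  «indexed by sufficiently small open compact subgroups `K`»; x2 g3 T1 (vii)), a non-zero `φ ∈ Hom_E(A_K, A_μ)_ℚ` at an open compact
  `K ≤ Ksm` yields, on SOME component `P_Γ(V)` of the tree's `V`-tower and for some Albanese datum `𝒥` of it, a non-zero
  `Alb(P_Γ(V)) ⟶ A_μ ⊗_{E,ι₁} ℂ`».
  PRINTED as: [Liu2021] §4.2, l. 2060–2076 (`X_K := \tilde Sh(𝕍)_K` smooth projective over `E`, transition maps `u^{K'}_K`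
  «generically finite dominant», `A_K := Alb_{X_K}`, the projective system `{A_K}_K`) with App. C Prop. C.5 (`pr:incoherent_shimura`,
  l. 4627–4633: «for every `τ ∈ Φ_F` and every `τ' ∈ Φ_E` above it … `{Sh(𝕍)_K ⊗_{E,τ'} τ'(E)}_K ≃ {Sh(G(τ), h_{V(τ),τ'})_K}_K`»,
  `V(τ)` the `τ`-nearby hermitian space of Def. C.4 l. 4620–4622 — fixed isomorphism `𝕍 ⊗ 𝔸_F^∞ ≃ V(τ) ⊗_F 𝔸_F^∞` l. 4624 —, signature `(n−1,1)` at `τ`) and the Shimura varieties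
  `Sh(G, h^♭)_K` of App. C l. 4575–4599 («quasi-projective and smooth … indexed by neat open compact subgroups `K` of
  `G(𝔸^∞) = U(V)(𝔸_F^∞)`»).  NOT PRINTED in [Liu2021] and used by this reading (red-team (A) DELTA 1/2 items (h2)/(h3); ASSUMED
  standard, sources NOT held in the literature store): (h2) the complex points of `Sh(Res U(V), h)_K` are
  `U(V)(F⁺)\[𝔹^{n−1} × U(V)(𝔸_{F⁺,f})/K] = ⊔_g Γ_g\𝔹^{n−1}`, `Γ_g = U(V)(F⁺) ∩ gKg⁻¹` (Deligne 1979 §2.1; Milne 2005 §5); (h3) a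
  connected component, a smooth projective surface with the same analytification `Γ_g\𝔹²` as the tree's
  `Var.scheme (ballQuotientUniformisedDatum_of h₁) h₃ (.pms (pmsCode F ι₁ V (Γ_g, gKg⁻¹)))` (`UnitaryBallUniformisationDatum.unif_eq_unif_iff`),
  is algebraically isomorphic to it (Chow/GAGA; cite of record at `PicardCMPrerequisites.lean`:296–300); (h4) Albanese of a
  disjoint union of connected smooth projective varieties is the product, Albanese commutes with base change, a surjective
  morphism induces a surjection of Albanese varieties (to pass from `K` to a neat `K' ≤ K`); (h5) base change
  `Hom_E(A_K, A_μ)_ℚ ↪ Hom(A_K ⊗_{E,ι₁} ℂ, A_μ ⊗_{E,ι₁} ℂ)_ℚ` is injective (tree theorem for REAL abelian varieties: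
  `AbelianVariety.lTensor_baseChange_ne_zero`, binder-1 p288061) and a non-zero homomorphism out of a finite product is non-zero
  on a factor (tree: `CMReach.exists_comp_ne_zero_of_iso_prod`).  So hReach is a consequence-reading of §4.2 + Prop. C.5
  TOGETHER WITH (h2)–(h4); uniform in `[F:ℚ]` and in the face; `V` of signature `(2,1)` at `ι₁|_{F⁺}`.  It is the tagged S2-CRUX
  (M-Sh) of hodge-director/ITEM6-SPLIT.md §(c⁹).

With the pin, the CM-side transfer «non-zero `X ⟶ A_μ ⊗ ℂ` ⇒ non-zero `X ⟶ A_{(F,Φ)}`» is binder-1's KERNEL theorem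
`Model.exists_hom_cmAV_ne_zero_of_isInverse_reflex` (`CorCM/CMSideReachOfInverseType.lean`, p283674: Shimura 1998 §6.2 Thm. 3 +
§6.1 Cor. of Thm. 2 over Riemann's theorem, and §8.3 Prop. 28 — the reflex pair of `Φ^{*ι₁}` induces `Φ`,
`CMReach.inducedCMType_reflexField_val_reflexCMType_of_isInverse`, all tree theorems), and the rest is the junction of record:
item6-p3's `Thm418Data.exists_homK_ne_zero_of_irreducible_smooth` (Thm. 4.18 (main) + (1) + a `μ`-admissible `ε` —
`Liu2021.exists_isAdmissibleElement_of_cmType` — + Def. 4.11 «irreducible admissible» ⟹ `Hom_E(A_K, A_μ)_ℚ ∋ φ ≠ 0` at every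
sufficiently small open compact `K`) and item6-p1's
`faceSupply_of_albaneseFactor` (isotypicity and level joining on `U_rec`).

* §1 `Model.faceSupply_of_thm418AsPrinted_pinned` — `(D) (Aμ) (hLiu) (hObj) (hChi) (hirr) (hsm) (hμ) (hCM) (hReach) ⟹ U.FaceSupply`,
  every Liu-side binder a VERBATIM printed sentence (Thm. 4.18; Prop. 4.6 (1); Def. 4.11; Def. 4.5 (2) with Def. 4.3 (2)) or a
  CHOICE (`hμ`), the one consequence-reading being `hReach` (the S2-CRUX (M-Sh) of hodge-director/ITEM6-SPLIT.md §(c⁹)); and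
  `Model.exists_supplyWitness_of_thm418AsPrinted_pinned` — the same ⟹ the supply clause of item (vi) in the ∃ι₁ ∃V form (S2-∃).
* §2 END DISPLAY `Model.hc_cm_of_thm418AsPrinted_pinned (U) (hU : U = U_rec) (D) (Aμ) (hLiu hObj hChi hirr hsm hμ hCM hReach) (hD) :
  HC_CM` — by name `hc_cm_of_supply_of_dictionary_of_eq` (tr-prover-6, `Item6HoldsRec.lean`) ∘ `exists_supplyWitness_of_faceSupply`
  ∘ §1; `hD` = items (iii)+(v) at `Θ := Uiso` verbatim from that file (its content includes THETA EXHAUSTION of `U_ψ`, [Liu2021]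
  Prop. 4.13 / Rem. 4.14 — in no as-printed binder).  [GR91 Prop. 3.1.1] (`GelbartRogawski1991.Prop311AsPrinted`, p277859) does
  not enter this (saturated-set) path.
* The STRENGTH CERTIFICATE is the companion file `Item6SupplyPinnedCertificate.lean`: given `hLiu`/`hObj`/`hChi`/`hirr`/`hsm`/`hμ`,
  «some pin satisfies (hCM, hReach)» ⟺ B01-S, and such Liu-side data exist Shimura-freely — the KERNEL CONTENT of the display is
  unchanged (B01-S, exactly as `thm418AsPrinted_match_iff_faceSupply` certifies for `hMatch`); what the pin changes is the
  CLASSIFICATION of the residual at the intended instantiation: a choice (`hμ`) plus two consequence-readings of PRINTED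
  [Liu2021] sentences (Def. 4.5 (2) + Def. 4.3 (2); §4.2 + App. C Prop. C.5) instead of one unprinted object match.  Whether those
  readings are EXACT or OVER-BROAD at face generality is red-team (A)'s call (AUDIT-CITESCOPE), not this file's.

NOT claimed: that Liu's objects have been CONSTRUCTED (every carrier of `D` and the pin `Aμ` are the consumer's; an auditor checks
the intended instantiation `𝕍` := the incoherent space nearby `V` at `ι₁|_{F⁺}`, `G := U(V)(𝔸_{F⁺,f})`, `HomK K D_μ := Hom_E(A_K,
A_μ)_ℚ`, `Aμ D_μ := A_μ ⊗_{E,ι₁} ℂ`, `M := M_μ ⊇ M'_μ ≅ K*`); that HC_CM is proved (`hCM`, `hReach`, `hD` are not inhabited in the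
tree); that the as-printed citation is EXACT at face generality (red-team (A)).

References: Y. Liu, *Fourier–Jacobi cycles and arithmetic relative trace formula*, Camb. J. Math. 9 (2021) = arXiv:2102.11518
(`FJcycle.tex` md5 6db49a74122d): Def. 4.3 (2) l. 1914–1921, Def. 4.5 l. 1936–1964, Prop. 4.6 (1) l. 1966–1969, §4.2 l. 2053–2076,
Def. 4.11 l. 2083–2097, Def. 4.12 l. 2102–2110, Def. 4.16 / Rem. 4.17 l. 2218–2228, Thm. 4.18 l. 2232–2245, App. C l. 4566–4599,
Def. C.3 l. 4614–4616, Def. C.4 l. 4620–4622, Prop. C.5 l. 4627–4637, App. D Lem. D.1 (1) l. 5226–5229; G. Shimura, *Abelian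
Varieties with Complex Multiplication and Modular Functions* (1998) §6.1, §6.2 Thm. 3, §8.3 Prop. 28.
-/

noncomputable section

open scoped TensorProduct InnerProductSpace

namespace Summit.HodgeConjecture.CorCM.Model

open CategoryTheory AlgebraicGeometry NumberField
open Literature.AlgebraicGeometry.Motives
open Literature.AlgebraicGeometry.Motives.HodgeStructure (conj)
open Literature.AlgebraicGeometry.HodgeTheory
open Literature.AlgebraicGeometry.ComplexMultiplication (IsCMTypeRealisation)
open Literature.NumberTheory.ComplexMultiplication
open Literature.NumberTheory.Automorphic
open Literature.NumberTheory.Automorphic.PicardCM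
open Literature.NumberTheory.Automorphic.Liu2021

/-! ## §1  S2 from [Liu 2021, Thm. 4.18] AS PRINTED at a pinned datum: `hMatch` ↦ (`Aμ`, `hμ`, `hCM`, `hReach`) -/

section Data

variable (hHD : exists_isReal_hodgeModel) (hI : hodgePQ_independent_of_hodgeModel)
  (h₁ : BallQuotientUniformised) (h₃ : CMAbelianVarietyRealised)

/-- **B01-S from [Liu 2021, Thm. 4.18] AS PRINTED at a PINNED datum** (`U = picardCMUniverse hHD hI h₁ h₃`).  Per face context
`(F, ι₁, V)` and CM type `Φ` the consumer supplies its own datum `D F ι₁ V Φ : Thm418Data F⁺ F` and, per object `D_μ ∈ 𝒜(μ)`, the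
complex abelian variety `Aμ F ι₁ V Φ D_μ` (intended: `A_μ ⊗_{E,ι₁} ℂ`).  Binders, each demanded only for Galois CM `F` with
`6 ≤ [F:ℚ]`, `Φ ∋ ι₁`, every `V`:
* `hLiu`   — THE CITE BINDER: [Liu2021] Thm. 4.18 exactly as printed for that datum (`Liu2021.Thm418AsPrinted`);
* `hObj`   — `𝒜(μ) ≠ ∅` ([Liu2021] Prop. 4.6 (1), `FJcycle.tex` l. 1969);
* `hChi`   — one automorphic character `χ` of `E¹\(𝔸_E^∞)¹` (Def. 4.11, l. 2090; the trivial one);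
* `hirr`, `hsm` — VERBATIM [Liu2021] Def. 4.11, l. 2096: each `ω(μ,ε,χ)` «is an irreducible admissible representation of
             `𝔾(𝔸_F^∞)`» — `IsIrreducible` + every vector fixed by an OPEN subgroup (the smoothness half of «admissible»; the
             finiteness half is not needed and not typed — weaker than print, never stronger);
* `hμ`     — the CHOICE of `μ`: the datum's `Φ_μ` (`Thm418Data.cmType`) is the inverse type `Φ^{*ι₁}` (`ι₁ ∘ g ∈ Φ_μ ↔ ι₁ ∘ g⁻¹ ∈ Φ`);
* `hCM`    — C6b\* VERBATIM [Liu2021] Def. 4.5 (2) l. 1944–1951 with (1) l. 1939–1942 and Def. 4.3 (2) l. 1919 at the dictionary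
             `M := M_μ`, `e := (K* ≅ M'_μ ⊆ M_μ)`: `Aμ … D_μ` realises over a CM field `M` the type induced along `e : K* → M` from
             the reflex pair `(K*, Φ_μ*)` of the datum's `Φ_μ` read through `ι₁` (consequence-reading; identification `M'_μ ≅ K*`
             is construction data);
* `hReach` — C0/C6a: below SOME open compact `Ksm` («sufficiently small», §4.2 l. 2060), a non-zero `φ ∈ Hom_E(A_K, A_μ)_ℚ` at an
             open compact `K ≤ Ksm` yields a non-zero `Alb(P_Γ(V)) ⟶ Aμ … D_μ` on some component `P_Γ(V)` of the tree's `V`-tower,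
             for some Albanese datum ([Liu2021] §4.2 l. 2060–2076 + App. C Prop. C.5 l. 4627–4633, read TOGETHER WITH the non-Liu
             inputs (h2) complex uniformisation (Deligne; not printed in [Liu2021], not held — ASSUMED), (h3) Chow/GAGA, (h4)
             Albanese functoriality of the module docstring; consequence-reading = the S2-CRUX (M-Sh)).
KERNEL: item6-p3's `Thm418Data.exists_homK_ne_zero_of_irreducible_smooth` (`φ ≠ 0` at every small open compact `K`; intersected
with `Ksm`), `hReach`, binder-1's
`exists_hom_cmAV_ne_zero_of_isInverse_reflex` (Shimura §6 over Riemann + §8.3 Prop. 28, tree theorems), item6-p1's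
`faceSupply_of_albaneseFactor`.  No degree- or face-specific input.  HC_CM is NOT proved; `hCM`/`hReach` are not inhabited here.
[cite: Liu2021, Thm. 4.18 (FJcycle.tex l. 2232–2245)] -/
theorem faceSupply_of_thm418AsPrinted_pinned
    (D : ∀ (F : CMField) (ι₁ : F →+* ℂ) (_ : HermSpace3 F ι₁) (_ : CMType F), Thm418Data (maximalRealSubfield F) F)
    (Aμ : ∀ (F : CMField) (ι₁ : F →+* ℂ) (V : HermSpace3 F ι₁) (Φ : CMType F), (D F ι₁ V Φ).Obj → AbelianVariety ℂ)
    (hLiu : ∀ (F : CMField), IsGalois ℚ F → 6 ≤ Module.finrank ℚ F → ∀ (Φ : CMType F) (ι₁ : F →+* ℂ), ι₁ ∈ Φ.1 →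
      ∀ V : HermSpace3 F ι₁, Thm418AsPrinted (D F ι₁ V Φ))
    (hObj : ∀ (F : CMField), IsGalois ℚ F → 6 ≤ Module.finrank ℚ F → ∀ (Φ : CMType F) (ι₁ : F →+* ℂ), ι₁ ∈ Φ.1 →
      ∀ V : HermSpace3 F ι₁, Nonempty (D F ι₁ V Φ).Obj)
    (hChi : ∀ (F : CMField), IsGalois ℚ F → 6 ≤ Module.finrank ℚ F → ∀ (Φ : CMType F) (ι₁ : F →+* ℂ), ι₁ ∈ Φ.1 →
      ∀ V : HermSpace3 F ι₁, Nonempty (D F ι₁ V Φ).Chi)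
    (hirr : ∀ (F : CMField), IsGalois ℚ F → 6 ≤ Module.finrank ℚ F → ∀ (Φ : CMType F) (ι₁ : F →+* ℂ), ι₁ ∈ Φ.1 →
      ∀ (V : HermSpace3 F ι₁) (i : (D F ι₁ V Φ).AdmIndex), ((D F ι₁ V Φ).rhoAt i).IsIrreducible)
    (hsm : ∀ (F : CMField), IsGalois ℚ F → 6 ≤ Module.finrank ℚ F → ∀ (Φ : CMType F) (ι₁ : F →+* ℂ), ι₁ ∈ Φ.1 →
      ∀ (V : HermSpace3 F ι₁) (i : (D F ι₁ V Φ).AdmIndex) (v : (D F ι₁ V Φ).omegaAt i),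
        ∃ S : Subgroup (D F ι₁ V Φ).G, IsOpen (S : Set (D F ι₁ V Φ).G) ∧ ∀ k ∈ S, (D F ι₁ V Φ).rhoAt i k v = v)
    (hμ : ∀ (F : CMField), IsGalois ℚ F → 6 ≤ Module.finrank ℚ F → ∀ (Φ : CMType F) (ι₁ : F →+* ℂ), ι₁ ∈ Φ.1 →
      ∀ (V : HermSpace3 F ι₁) (g : F ≃ₐ[ℚ] F),
        ι₁.comp (g : F →+* F) ∈ (D F ι₁ V Φ).cmType.1 ↔ ι₁.comp (g.symm : F →+* F) ∈ Φ.1)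
    (hCM : ∀ (F : CMField) [IsGalois ℚ F], 6 ≤ Module.finrank ℚ F → ∀ (Φ : CMType F) (ι₁ : F →+* ℂ), ι₁ ∈ Φ.1 →
      ∀ (V : HermSpace3 F ι₁) (Dμ : (D F ι₁ V Φ).Obj),
        ∃ (M : Type) (_ : Field M) (_ : NumberField M) (_ : IsCMField M)
          (e : reflexField ℚ F (algValuedIn ι₁ (D F ι₁ V Φ).cmType.1) →+* M)
          (ιB : 𝓞 M →+* End (Aμ F ι₁ V Φ Dμ)) (θB : M →+* Module.End ℂ (complexBetti (Aμ F ι₁ V Φ Dμ).X 1)),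
          IsCMTypeRealisation (inducedCMType e (reflexCMType ι₁ (D F ι₁ V Φ).cmType (AlgHom.id ℚ F))) (Aμ F ι₁ V Φ Dμ) ιB θB)
    (hReach : ∀ (F : CMField), IsGalois ℚ F → 6 ≤ Module.finrank ℚ F → ∀ (Φ : CMType F) (ι₁ : F →+* ℂ), ι₁ ∈ Φ.1 →
      ∀ V : HermSpace3 F ι₁, ∃ Ksm : Subgroup (D F ι₁ V Φ).G, IsOpenCompact Ksm ∧
        ∀ (K : Subgroup (D F ι₁ V Φ).G) (Dμ : (D F ι₁ V Φ).Obj) (φ : (D F ι₁ V Φ).HomK K Dμ),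
          IsOpenCompact K → K ≤ Ksm → φ ≠ 0 →
            ∃ (Γ : Level V) (𝒥 : Jacobian (Var.scheme (ballQuotientUniformisedDatum_of h₁) h₃ (.pms (pmsCode F ι₁ V Γ))))
              (w : 𝒥.J ⟶ Aμ F ι₁ V Φ Dμ), w ≠ 0) :
    (picardCMUniverse hHD hI h₁ h₃).FaceSupply := by
  refine faceSupply_of_albaneseFactor hHD hI h₁ h₃ fun F hG h6 Φ ι₁ hι V => ?_
  haveI := hG
  obtain ⟨χ⟩ := hChi F hG h6 Φ ι₁ hι V
  obtain ⟨Dμ⟩ := hObj F hG h6 Φ ι₁ hι V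
  obtain ⟨Ksm, hKsm, hreach⟩ := hReach F hG h6 Φ ι₁ hι V
  obtain ⟨K₀, hK₀, hK⟩ := Thm418Data.exists_homK_ne_zero_of_irreducible_smooth (hLiu F hG h6 Φ ι₁ hι V) Dμ χ
    (hirr F hG h6 Φ ι₁ hι V) (hsm F hG h6 Φ ι₁ hι V)
  have hKK : IsOpenCompact (K₀ ⊓ Ksm) := by
    refine ⟨?_, ?_⟩ <;> rw [Subgroup.coe_inf]
    · exact hK₀.1.inter hKsm.1
    · exact hK₀.2.inter_right (Subgroup.isClosed_of_isOpen Ksm hKsm.1)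
  obtain ⟨φ, hφ⟩ := hK (K₀ ⊓ Ksm) hKK inf_le_left
  obtain ⟨Γ, 𝒥, w, hw⟩ := hreach (K₀ ⊓ Ksm) Dμ φ hKK inf_le_right hφ
  obtain ⟨M, iFM, iNM, iCM, e, ιB, θB, hB⟩ := hCM F h6 Φ ι₁ hι V Dμ
  exact ⟨Γ, 𝒥, exists_hom_cmAV_ne_zero_of_isInverse_reflex h₃ F ι₁ (hμ F hG h6 Φ ι₁ hι V) e hB hw⟩

/-- **(S2-∃) from [Liu 2021, Thm. 4.18] AS PRINTED at a pinned datum** — the supply clause of item (vi) in the ∃ι₁ ∃V ∃Γ form the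
day-1 assembly consumes (§1 ∘ item6-p1's `exists_supplyWitness_of_faceSupply`).  HC_CM is NOT proved.
[cite: Liu2021, Thm. 4.18 (FJcycle.tex l. 2232–2245)] -/
theorem exists_supplyWitness_of_thm418AsPrinted_pinned
    (D : ∀ (F : CMField) (ι₁ : F →+* ℂ) (_ : HermSpace3 F ι₁) (_ : CMType F), Thm418Data (maximalRealSubfield F) F)
    (Aμ : ∀ (F : CMField) (ι₁ : F →+* ℂ) (V : HermSpace3 F ι₁) (Φ : CMType F), (D F ι₁ V Φ).Obj → AbelianVariety ℂ)
    (hLiu : ∀ (F : CMField), IsGalois ℚ F → 6 ≤ Module.finrank ℚ F → ∀ (Φ : CMType F) (ι₁ : F →+* ℂ), ι₁ ∈ Φ.1 →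
      ∀ V : HermSpace3 F ι₁, Thm418AsPrinted (D F ι₁ V Φ))
    (hObj : ∀ (F : CMField), IsGalois ℚ F → 6 ≤ Module.finrank ℚ F → ∀ (Φ : CMType F) (ι₁ : F →+* ℂ), ι₁ ∈ Φ.1 →
      ∀ V : HermSpace3 F ι₁, Nonempty (D F ι₁ V Φ).Obj)
    (hChi : ∀ (F : CMField), IsGalois ℚ F → 6 ≤ Module.finrank ℚ F → ∀ (Φ : CMType F) (ι₁ : F →+* ℂ), ι₁ ∈ Φ.1 →
      ∀ V : HermSpace3 F ι₁, Nonempty (D F ι₁ V Φ).Chi)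
    (hirr : ∀ (F : CMField), IsGalois ℚ F → 6 ≤ Module.finrank ℚ F → ∀ (Φ : CMType F) (ι₁ : F →+* ℂ), ι₁ ∈ Φ.1 →
      ∀ (V : HermSpace3 F ι₁) (i : (D F ι₁ V Φ).AdmIndex), ((D F ι₁ V Φ).rhoAt i).IsIrreducible)
    (hsm : ∀ (F : CMField), IsGalois ℚ F → 6 ≤ Module.finrank ℚ F → ∀ (Φ : CMType F) (ι₁ : F →+* ℂ), ι₁ ∈ Φ.1 →
      ∀ (V : HermSpace3 F ι₁) (i : (D F ι₁ V Φ).AdmIndex) (v : (D F ι₁ V Φ).omegaAt i),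
        ∃ S : Subgroup (D F ι₁ V Φ).G, IsOpen (S : Set (D F ι₁ V Φ).G) ∧ ∀ k ∈ S, (D F ι₁ V Φ).rhoAt i k v = v)
    (hμ : ∀ (F : CMField), IsGalois ℚ F → 6 ≤ Module.finrank ℚ F → ∀ (Φ : CMType F) (ι₁ : F →+* ℂ), ι₁ ∈ Φ.1 →
      ∀ (V : HermSpace3 F ι₁) (g : F ≃ₐ[ℚ] F),
        ι₁.comp (g : F →+* F) ∈ (D F ι₁ V Φ).cmType.1 ↔ ι₁.comp (g.symm : F →+* F) ∈ Φ.1)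
    (hCM : ∀ (F : CMField) [IsGalois ℚ F], 6 ≤ Module.finrank ℚ F → ∀ (Φ : CMType F) (ι₁ : F →+* ℂ), ι₁ ∈ Φ.1 →
      ∀ (V : HermSpace3 F ι₁) (Dμ : (D F ι₁ V Φ).Obj),
        ∃ (M : Type) (_ : Field M) (_ : NumberField M) (_ : IsCMField M)
          (e : reflexField ℚ F (algValuedIn ι₁ (D F ι₁ V Φ).cmType.1) →+* M)
          (ιB : 𝓞 M →+* End (Aμ F ι₁ V Φ Dμ)) (θB : M →+* Module.End ℂ (complexBetti (Aμ F ι₁ V Φ Dμ).X 1)),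
          IsCMTypeRealisation (inducedCMType e (reflexCMType ι₁ (D F ι₁ V Φ).cmType (AlgHom.id ℚ F))) (Aμ F ι₁ V Φ Dμ) ιB θB)
    (hReach : ∀ (F : CMField), IsGalois ℚ F → 6 ≤ Module.finrank ℚ F → ∀ (Φ : CMType F) (ι₁ : F →+* ℂ), ι₁ ∈ Φ.1 →
      ∀ V : HermSpace3 F ι₁, ∃ Ksm : Subgroup (D F ι₁ V Φ).G, IsOpenCompact Ksm ∧
        ∀ (K : Subgroup (D F ι₁ V Φ).G) (Dμ : (D F ι₁ V Φ).Obj) (φ : (D F ι₁ V Φ).HomK K Dμ),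
          IsOpenCompact K → K ≤ Ksm → φ ≠ 0 →
            ∃ (Γ : Level V) (𝒥 : Jacobian (Var.scheme (ballQuotientUniformisedDatum_of h₁) h₃ (.pms (pmsCode F ι₁ V Γ))))
              (w : 𝒥.J ⟶ Aμ F ι₁ V Φ Dμ), w ≠ 0) :
    ∀ (F : CMField), IsGalois ℚ F → 6 ≤ Module.finrank ℚ F → ∀ f : Face F,
      ∃ ι₁ : F →+* ℂ, f.Admissible ι₁ ∧ ∃ (V : HermSpace3 F ι₁) (Γ : Level V)
        (ω₀ ω₁ : (picardCMUniverse hHD hI h₁ h₃).CohC ((picardCMUniverse hHD hI h₁ h₃).pms F ι₁ V Γ) 1),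
        ω₀ ∈ (picardCMUniverse hHD hI h₁ h₃).Uiso Γ F (f.psi 0) ι₁ ∧
          ω₁ ∈ (picardCMUniverse hHD hI h₁ h₃).Uiso Γ F (f.psi 1) ι₁ ∧ ω₀ ≠ 0 ∧ ω₁ ≠ 0 :=
  exists_supplyWitness_of_faceSupply hHD hI h₁ h₃
    (faceSupply_of_thm418AsPrinted_pinned hHD hI h₁ h₃ D Aμ hLiu hObj hChi hirr hsm hμ hCM hReach)

end Data

/-! ## §2  THE END DISPLAY on the universe of record -/

section EndState

/-- **END DISPLAY at a pinned datum** (`hU : U = U_rec`, instantiate with `rfl`): `HC_CM` from [Liu 2021, Thm. 4.18] AS PRINTED (`hLiu`),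
its printed-elsewhere carriers (`hObj` Prop. 4.6 (1); `hChi` Def. 4.11; `hirr`/`hsm` Def. 4.11 «irreducible admissible»), the CHOICE `hμ`
(`Φ_μ = Φ^{*ι₁}`),
the PIN `Aμ` with `hCM` (Def. 4.5 (1)–(2) + Def. 4.3 (2) at the dictionary) and `hReach` (§4.2 + App. C Prop. C.5 read with the
non-Liu inputs (h2)–(h4) of the module docstring — the S2-CRUX) —
every one GUARDED to Galois CM `F`, `6 ≤ [F:ℚ]`, `Φ ∋ ι₁` — and the `L²` dictionary with isolation `hD` (items (iii)+(v) at
`Θ := Uiso`, verbatim from `hc_cm_of_supply_of_dictionary_of_eq`; its content includes THETA EXHAUSTION of `U_ψ`, [Liu2021]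
Prop. 4.13 / Rem. 4.14, in no as-printed binder).  Composition BY NAME: `hc_cm_of_supply_of_dictionary_of_eq` ∘
`exists_supplyWitness_of_faceSupply` ∘ `faceSupply_of_thm418AsPrinted_pinned`.  [GR91 Prop. 3.1.1] does not enter.  HC_CM is NOT
proved: `hCM`, `hReach`, `hD` are not inhabited, and by the certificate file the pin adds no kernel content toward S2.
[cite: Liu2021, Thm. 4.18 (FJcycle.tex l. 2232–2245)] -/
theorem hc_cm_of_thm418AsPrinted_pinned (U : Universe)
    (hU : U = picardCMUniverse exists_isReal_hodgeModel_holds hodgePQ_independent_of_hodgeModel_holds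
      BallQuotient.ballQuotientUniformised_holds cmAbelianVarietyRealised_holds)
    (D : ∀ (F : CMField) (ι₁ : F →+* ℂ) (_ : HermSpace3 F ι₁) (_ : CMType F), Thm418Data (maximalRealSubfield F) F)
    (Aμ : ∀ (F : CMField) (ι₁ : F →+* ℂ) (V : HermSpace3 F ι₁) (Φ : CMType F), (D F ι₁ V Φ).Obj → AbelianVariety ℂ)
    (hLiu : ∀ (F : CMField), IsGalois ℚ F → 6 ≤ Module.finrank ℚ F → ∀ (Φ : CMType F) (ι₁ : F →+* ℂ), ι₁ ∈ Φ.1 →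
      ∀ V : HermSpace3 F ι₁, Thm418AsPrinted (D F ι₁ V Φ))
    (hObj : ∀ (F : CMField), IsGalois ℚ F → 6 ≤ Module.finrank ℚ F → ∀ (Φ : CMType F) (ι₁ : F →+* ℂ), ι₁ ∈ Φ.1 →
      ∀ V : HermSpace3 F ι₁, Nonempty (D F ι₁ V Φ).Obj)
    (hChi : ∀ (F : CMField), IsGalois ℚ F → 6 ≤ Module.finrank ℚ F → ∀ (Φ : CMType F) (ι₁ : F →+* ℂ), ι₁ ∈ Φ.1 →
      ∀ V : HermSpace3 F ι₁, Nonempty (D F ι₁ V Φ).Chi)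
    (hirr : ∀ (F : CMField), IsGalois ℚ F → 6 ≤ Module.finrank ℚ F → ∀ (Φ : CMType F) (ι₁ : F →+* ℂ), ι₁ ∈ Φ.1 →
      ∀ (V : HermSpace3 F ι₁) (i : (D F ι₁ V Φ).AdmIndex), ((D F ι₁ V Φ).rhoAt i).IsIrreducible)
    (hsm : ∀ (F : CMField), IsGalois ℚ F → 6 ≤ Module.finrank ℚ F → ∀ (Φ : CMType F) (ι₁ : F →+* ℂ), ι₁ ∈ Φ.1 →
      ∀ (V : HermSpace3 F ι₁) (i : (D F ι₁ V Φ).AdmIndex) (v : (D F ι₁ V Φ).omegaAt i),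
        ∃ S : Subgroup (D F ι₁ V Φ).G, IsOpen (S : Set (D F ι₁ V Φ).G) ∧ ∀ k ∈ S, (D F ι₁ V Φ).rhoAt i k v = v)
    (hμ : ∀ (F : CMField), IsGalois ℚ F → 6 ≤ Module.finrank ℚ F → ∀ (Φ : CMType F) (ι₁ : F →+* ℂ), ι₁ ∈ Φ.1 →
      ∀ (V : HermSpace3 F ι₁) (g : F ≃ₐ[ℚ] F),
        ι₁.comp (g : F →+* F) ∈ (D F ι₁ V Φ).cmType.1 ↔ ι₁.comp (g.symm : F →+* F) ∈ Φ.1)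
    (hCM : ∀ (F : CMField) [IsGalois ℚ F], 6 ≤ Module.finrank ℚ F → ∀ (Φ : CMType F) (ι₁ : F →+* ℂ), ι₁ ∈ Φ.1 →
      ∀ (V : HermSpace3 F ι₁) (Dμ : (D F ι₁ V Φ).Obj),
        ∃ (M : Type) (_ : Field M) (_ : NumberField M) (_ : IsCMField M)
          (e : reflexField ℚ F (algValuedIn ι₁ (D F ι₁ V Φ).cmType.1) →+* M)
          (ιB : 𝓞 M →+* End (Aμ F ι₁ V Φ Dμ)) (θB : M →+* Module.End ℂ (complexBetti (Aμ F ι₁ V Φ Dμ).X 1)),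
          IsCMTypeRealisation (inducedCMType e (reflexCMType ι₁ (D F ι₁ V Φ).cmType (AlgHom.id ℚ F))) (Aμ F ι₁ V Φ Dμ) ιB θB)
    (hReach : ∀ (F : CMField), IsGalois ℚ F → 6 ≤ Module.finrank ℚ F → ∀ (Φ : CMType F) (ι₁ : F →+* ℂ), ι₁ ∈ Φ.1 →
      ∀ V : HermSpace3 F ι₁, ∃ Ksm : Subgroup (D F ι₁ V Φ).G, IsOpenCompact Ksm ∧
        ∀ (K : Subgroup (D F ι₁ V Φ).G) (Dμ : (D F ι₁ V Φ).Obj) (φ : (D F ι₁ V Φ).HomK K Dμ),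
          IsOpenCompact K → K ≤ Ksm → φ ≠ 0 →
            ∃ (Γ : Level V) (𝒥 : Jacobian (Var.scheme (ballQuotientUniformisedDatum_of BallQuotient.ballQuotientUniformised_holds)
                cmAbelianVarietyRealised_holds (.pms (pmsCode F ι₁ V Γ))))
              (w : 𝒥.J ⟶ Aμ F ι₁ V Φ Dμ), w ≠ 0)
    (hD : ∀ (F : CMField), IsGalois ℚ F → 6 ≤ Module.finrank ℚ F → ∀ (f : Face F) (ι₁ : F →+* ℂ), f.Admissible ι₁ →
      ∀ V : HermSpace3 F ι₁,
        ∃ (HG : Type) (_ : NormedAddCommGroup HG) (_ : InnerProductSpace ℂ HG)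
          (emb : ∀ Γ : Level V, U.CohC (U.pms F ι₁ V Γ) 2 →ₗ[ℂ] HG)
          (cover : ∀ (Γ Γ' : Level V), Γ' ≤ Γ → U.Mor (U.pms F ι₁ V Γ') (U.pms F ι₁ V Γ)),
          (∀ (Γ : Level V) (ω₁ ω₂ : U.CohC (U.pms F ι₁ V Γ) 1), ω₁ ∈ U.Uiso Γ F (f.psi 0) ι₁ → ω₂ ∈ U.Uiso Γ F (f.psi 1) ι₁ →
            emb Γ (U.cup2C (U.pms F ι₁ V Γ) 1 ω₁ ω₂) ∈ (Submodule.span ℂ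
              {x : HG | ∃ (Γ' : Level V), ∃ ω₃ ∈ U.Uiso Γ' F (f.psi 2) ι₁, ∃ ω₄ ∈ U.Uiso Γ' F (f.psi 3) ι₁,
                x = emb Γ' (U.cup2C (U.pms F ι₁ V Γ') 1 ω₃ ω₄)}).topologicalClosure) ∧
          (∀ (Γ Γ' : Level V) (hle : Γ' ≤ Γ) (x : U.CohC (U.pms F ι₁ V Γ) 2),
            emb Γ' (U.pullC (cover Γ Γ' hle) 2 x) = emb Γ x) ∧
          (∀ Γ : Level V, ∃ c : ℂ, c ≠ 0 ∧ ∀ x y : U.CohC (U.pms F ι₁ V Γ) 2,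
            x ∈ (U.hodge (U.pms F ι₁ V Γ) 2).F 2 → y ∈ (U.hodge (U.pms F ι₁ V Γ) 2).F 2 →
              ⟪emb Γ y, emb Γ x⟫_ℂ = c * U.trC (U.pms F ι₁ V Γ) 4 (U.cup2C (U.pms F ι₁ V Γ) 2 x (conj y)))) :
    HC_CM := by
  subst hU
  exact hc_cm_of_supply_of_dictionary_of_eq _ rfl
    (exists_supplyWitness_of_faceSupply _ _ _ _
      (faceSupply_of_thm418AsPrinted_pinned _ _ _ _ D Aμ hLiu hObj hChi hirr hsm hμ hCM hReach)) hD

end EndState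

end Summit.HodgeConjecture.CorCM.Model

end
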